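import Summits.CriticalPhenomena.PercolationContinuityZ3.Theorems.PercNearOneGluingNoHeavyLowerTailKnQuestion8CoefficientwiseCoreClassKernelMixBundleWords
import HarnessLib

/-!
# Boundary inequality on bundles, VII: the general fibre transfer (whole-thread lifts, first-edge lifts, red prefixes, free threads)

Support file (`--supports stmt-CriticalPhenomena-4575`, closed), prover `prim-cplus-coupling` (gen 46).  No definitions, no notations, no named facts,
no sorries; standard axioms.  Memo `prim-cplus-coupling/A5-COUPLING-gen46.md` §2.5 (the 'chain fibre') and `A5-COUPLING-gen45.md` §3.9(a).

All Harris flows of the LP1 programme have the same shape: a FIBRE fixes, thread by thread, one of four patterns, Harris runs on the remaining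
coordinates, and a LIFT turns the landing `ξ` into a supply point `λ`.  Per thread `t` (kind `κ t`):
* `κ t = 0` — LIFT-ALL: the thread is fully red in `λ` (memo-45: the frozen empty threads `K`; nothing about `ξ`, `ρ` on it is needed);
* `κ t = 1` — LIFT-FIRST: the first edge is blue in `ξ` and `ρ`, the other edges of `ρ` are the complement of those of `ξ`, and `λ` gets the first edge
  (memo-46 §2.5(i), the 'chain fibre' for blue-starting threads);
* `κ t = 2` — PREFIX/FREE with length `a t < L t`: the first `a t` edges red in `ξ` and `ρ`, edge `a t + 1` blue in both if `a t ≥ 1`, the remaining edges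
  complementary (`a t = 0`: the whole thread complementary); `λ = ξ` on the thread (memo-45 §3.9(a)).
THEOREM `Coefficientwise.bundle_fibre_transfer`: if `ρ` has no fully red thread and at least one fully blue thread, then `b ∈ C λ`, `b ∉ C(E∖λ)`,
`C(E∖ρ) ⊆ C λ` and `C(E∖λ) ⊆ C ρ` (`C = C_u`).  With `hro ξ`, `kbo ρ` this puts `λ` in `L₁ ∩ R` exactly as in `bundle_boundary_count`; `bundle_boundary_transfer`
is the case `κ = 0` off `{p, q}`, `κ = 2` on `{p, q}`.  [cite: KozmaNitzan2024, Questions 8–9 (§5.5 p. 36) (context)]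
-/

namespace Summit.CriticalPhenomena.PercolationContinuityZ3.Theorems

open Finset Literature.Probability.Percolation

namespace Coefficientwise

variable {ι V : Type*}

open Classical in
/-- **General fibre transfer on a bundle.**  See the module docstring: threads of kind LIFT-ALL (`κ t = 0`), LIFT-FIRST (`κ t = 1`), PREFIX/FREE (`κ t = 2`, length `a t`);
`ξ` the landing, `ρ` its partner, `λ` the lift (`e t j ∈ λ ↔ e t j ∈ ξ ∨ κ t = 0 ∨ (κ t = 1 ∧ j = 1)`).  If no thread is fully red in `ρ` and some thread is fully blue in `ρ`,
then `b ∈ C λ`, `b ∉ C(E ∖ λ)`, `C(E ∖ ρ) ⊆ C λ`, `C(E ∖ λ) ⊆ C ρ`.  Memo gen 46 §2.5, gen 45 §3.9(a).  [cite: KozmaNitzan2024, Questions 8–9 (§5.5 p. 36) (context)] -/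
theorem bundle_fibre_transfer (ends : ι → Sym2 V) (r : ℕ) (L : ℕ → ℕ) (hL : ∀ t, t < r → 1 ≤ L t)
    (w : ℕ → ℕ → V) (e : ℕ → ℕ → ι) (u b : V)
    (hw0 : ∀ t, t < r → w t 0 = u) (hwL : ∀ t, t < r → w t (L t) = b)
    (harc : ∀ t, t < r → ∀ j, 1 ≤ j → j ≤ L t → ends (e t j) = s(w t (j - 1), w t j))
    (hwinj : ∀ t, t < r → ∀ i j, i ≤ L t → j ≤ L t → w t i = w t j → i = j)
    (hcross : ∀ t t', t < r → t' < r → t ≠ t' → ∀ i j, i ≤ L t → j ≤ L t' → w t i = w t' j → (i = 0 ∧ j = 0) ∨ (i = L t ∧ j = L t'))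
    (A : ℕ → Finset ι) (hA : ∀ t, t < r → ∀ i, i ∈ A t ↔ ∃ j, 1 ≤ j ∧ j ≤ L t ∧ e t j = i)
    (E : Finset ι) (hEA : ∀ i, i ∈ E ↔ ∃ t, t < r ∧ i ∈ A t)
    (κ a : ℕ → ℕ) (ξ ρ lam : Finset ι) (hξ : ξ ⊆ E)
    (hlam : ∀ t, t < r → ∀ j, 1 ≤ j → j ≤ L t → (e t j ∈ lam ↔ (e t j ∈ ξ ∨ κ t = 0 ∨ (κ t = 1 ∧ j = 1))))
    (h1 : ∀ t, t < r → κ t = 1 → (e t 1 ∉ ξ ∧ e t 1 ∉ ρ) ∧ ∀ j, 2 ≤ j → j ≤ L t → (e t j ∈ ρ ↔ e t j ∉ ξ))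
    (h2 : ∀ t, t < r → κ t = 2 → a t < L t ∧ (∀ j, 1 ≤ j → j ≤ a t → e t j ∈ ξ ∧ e t j ∈ ρ) ∧ (1 ≤ a t → e t (a t + 1) ∉ ξ ∧ e t (a t + 1) ∉ ρ) ∧
      (∀ j, 1 ≤ j → j ≤ L t → (a t = 0 ∨ a t + 2 ≤ j) → (e t j ∈ ρ ↔ e t j ∉ ξ)))
    (hκ : ∀ t, t < r → κ t = 0 ∨ κ t = 1 ∨ κ t = 2)
    (hnf : ∀ t, t < r → ∃ j, 1 ≤ j ∧ j ≤ L t ∧ e t j ∉ ρ) (hempty : ∃ t, t < r ∧ ∀ j, 1 ≤ j → j ≤ L t → e t j ∉ ρ) :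
    b ∈ openCluster (ends '' (↑lam : Set ι)) u ∧ b ∉ openCluster (ends '' (↑(E \ lam) : Set ι)) u ∧
    openCluster (ends '' (↑(E \ ρ) : Set ι)) u ⊆ openCluster (ends '' (↑lam : Set ι)) u ∧
    openCluster (ends '' (↑(E \ lam) : Set ι)) u ⊆ openCluster (ends '' (↑ρ : Set ι)) u := by
  set C : Finset ι → Set V := fun ω => openCluster (ends '' (↑ω : Set ι)) u with hC
  -- ## bookkeeping
  have hAE : ∀ t, t < r → A t ⊆ E := fun t ht i hi => (hEA i).mpr ⟨t, ht, hi⟩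
  have heA : ∀ t, t < r → ∀ j, 1 ≤ j → j ≤ L t → e t j ∈ A t := fun t ht j hj1 hjL => (hA t ht _).mpr ⟨j, hj1, hjL, rfl⟩
  have heE : ∀ t, t < r → ∀ j, 1 ≤ j → j ≤ L t → e t j ∈ E := fun t ht j hj1 hjL => hAE t ht (heA t ht j hj1 hjL)
  have hE : ∀ i, i ∈ E → ∃ t, t < r ∧ ∃ j, 1 ≤ j ∧ j ≤ L t ∧ e t j = i := by
    intro i hi
    obtain ⟨t, ht, hit⟩ := (hEA i).mp hi
    exact ⟨t, ht, (hA t ht i).mp hit⟩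
  have hξlam : ξ ⊆ lam := by
    intro i hi
    obtain ⟨t, ht, j, hj1, hjL, rfl⟩ := hE i (hξ hi)
    exact (hlam t ht j hj1 hjL).mpr (Or.inl hi)
  -- an edge of E ∖ ρ outside the frozen-blue positions is red in the lift
  have compl_red : ∀ t, t < r → ∀ j, 1 ≤ j → j ≤ L t → e t j ∉ ρ →
      (κ t = 2 ∧ 1 ≤ a t ∧ j = a t + 1) ∨ e t j ∈ lam := by
    intro t ht j hj1 hjL hnρ
    rcases hκ t ht with hk | hk | hk
    · exact Or.inr ((hlam t ht j hj1 hjL).mpr (Or.inr (Or.inl hk)))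
    · by_cases hj : j = 1
      · exact Or.inr ((hlam t ht j hj1 hjL).mpr (Or.inr (Or.inr ⟨hk, hj⟩)))
      · exact Or.inr (hξlam (((h1 t ht hk).2 j (by omega) hjL).not_left.mp hnρ))
    · obtain ⟨haL, hpre, hblue, hfree⟩ := h2 t ht hk
      by_cases hja : j ≤ a t
      · exact absurd (hpre j hj1 hja).2 hnρ
      by_cases hj : j = a t + 1 ∧ 1 ≤ a t
      · exact Or.inl ⟨hk, hj.2, hj.1⟩
      · have hfr : a t = 0 ∨ a t + 2 ≤ j := by omega
        exact Or.inr (hξlam ((hfree j hj1 hjL hfr).not_left.mp hnρ))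
  -- ## (F1): the fully blue thread of ρ is fully red in the lift
  obtain ⟨t₀, ht₀, hemp⟩ := hempty
  have full₀ : ∀ j, 1 ≤ j → j ≤ L t₀ → e t₀ j ∈ lam := by
    intro j hj1 hjL
    rcases compl_red t₀ ht₀ j hj1 hjL (hemp j hj1 hjL) with ⟨hk, ha1, hj⟩ | h
    · exfalso
      exact hemp (a t₀) ha1 (by have := (h2 t₀ ht₀ hk).1; omega) ((h2 t₀ ht₀ hk).2.1 (a t₀) ha1 (le_refl _)).2
    · exact h
  have hbX : b ∈ C lam := bundle_b_mem_cluster_of_full ends r L w e u b hw0 hwL harc lam t₀ ht₀ full₀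
  -- ## (F2): no thread is fully blue in the lift
  have red_edge : ∀ t, t < r → ∃ j, 1 ≤ j ∧ j ≤ L t ∧ e t j ∈ lam := by
    intro t ht
    rcases hκ t ht with hk | hk | hk
    · exact ⟨1, le_refl 1, hL t ht, (hlam t ht 1 (le_refl 1) (hL t ht)).mpr (Or.inr (Or.inl hk))⟩
    · exact ⟨1, le_refl 1, hL t ht, (hlam t ht 1 (le_refl 1) (hL t ht)).mpr (Or.inr (Or.inr ⟨hk, rfl⟩))⟩
    · obtain ⟨haL, hpre, hblue, hfree⟩ := h2 t ht hk
      by_cases ha0 : a t = 0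
      · obtain ⟨j, hj1, hjL, hnρ⟩ := hnf t ht
        exact ⟨j, hj1, hjL, hξlam ((hfree j hj1 hjL (Or.inl ha0)).not_left.mp hnρ)⟩
      · exact ⟨1, le_refl 1, hL t ht, hξlam (hpre 1 (le_refl 1) (by omega)).1⟩
  have no_full_compl : ∀ t, t < r → ∃ j, 1 ≤ j ∧ j ≤ L t ∧ e t j ∉ E \ lam := by
    intro t ht
    obtain ⟨j, hj1, hjL, hm⟩ := red_edge t ht
    exact ⟨j, hj1, hjL, fun h => (Finset.mem_sdiff.mp h).2 hm⟩
  have hbY : b ∉ C (E \ lam) := by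
    have hr : 0 < r := lt_of_le_of_lt (Nat.zero_le t₀) ht₀
    exact bundle_b_notMem_cluster_of_noFull ends r L hL w e u b hr hw0 hwL harc hwinj hcross E hE (E \ lam) Finset.sdiff_subset no_full_compl
  -- ## (T2): C(E ∖ ρ) ⊆ C λ
  have T2 : C (E \ ρ) ⊆ C lam := by
    intro v hv
    have h := bundle_cluster_subset_runs ends r L w e u b hw0 hwL harc hwinj hcross E hE (E \ ρ) Finset.sdiff_subset hv
    rcases h with hu | hb | ⟨t, ht, j, hj1, hjL, rfl, hruns⟩
    · rw [hu]; exact mem_openCluster_self _ _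
    · rw [hb]; exact hbX
    · rcases hruns with hrun | hrun
      · -- leading run in E ∖ ρ: every edge is red in the lift unless it is a frozen blue edge a t + 1 — impossible inside a leading run from position 1
        by_cases hk2 : κ t = 2 ∧ 1 ≤ a t
        · exfalso
          exact (Finset.mem_sdiff.mp (hrun 1 (le_refl 1) hj1)).2 ((h2 t ht hk2.1).2.1 1 (le_refl 1) hk2.2).2
        · refine bundle_prefix_mem_cluster ends r L w e u hw0 harc lam t ht j (le_of_lt hjL) fun j' h1' h2' => ?_
          rcases compl_red t ht j' h1' (by omega) (Finset.mem_sdiff.mp (hrun j' h1' h2')).2 with ⟨hk, ha1, _⟩ | h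
          · exact absurd ⟨hk, ha1⟩ hk2
          · exact h
      · -- trailing run in E ∖ ρ
        by_cases hk2 : κ t = 2 ∧ 1 ≤ a t ∧ j ≤ a t
        · -- inside the red prefix: j = a t, reached from u
          obtain ⟨hk, ha1, hja⟩ := hk2
          obtain ⟨haL, hpre, -, -⟩ := h2 t ht hk
          have hj : j = a t := by
            by_contra hne
            exact (Finset.mem_sdiff.mp (hrun (a t) (by omega) (le_of_lt haL))).2 (hpre (a t) ha1 (le_refl _)).2
          subst hj
          exact bundle_prefix_mem_cluster ends r L w e u hw0 harc lam t ht (a t) (le_of_lt hjL) fun j' h1' h2' => hξlam (hpre j' h1' h2').1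
        · refine bundle_suffix_mem_cluster ends r L w e u b hwL harc lam hbX t ht j (le_of_lt hjL) fun j' h1' h2' => ?_
          rcases compl_red t ht j' (by omega) h2' (Finset.mem_sdiff.mp (hrun j' h1' h2')).2 with ⟨hk, ha1, hj'⟩ | h
          · exfalso; exact hk2 ⟨hk, ha1, by omega⟩
          · exact h
  -- ## (T3): C(E ∖ λ) ⊆ C ρ
  have T3 : C (E \ lam) ⊆ C ρ := by
    intro v hv
    have h := bundle_cluster_subset_prefix ends r L w e u hw0 harc hwinj hcross E hE (E \ lam) Finset.sdiff_subset no_full_compl hv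
    rcases h with hu | ⟨t, ht, j, hj1, hjL, rfl, hrun⟩
    · rw [hu]; exact mem_openCluster_self _ _
    · have notlam : ∀ j', 1 ≤ j' → j' ≤ j → e t j' ∉ lam := fun j' h1' h2' => (Finset.mem_sdiff.mp (hrun j' h1' h2')).2
      rcases hκ t ht with hk | hk | hk
      · exact absurd ((hlam t ht 1 (le_refl 1) (hL t ht)).mpr (Or.inr (Or.inl hk))) (notlam 1 (le_refl 1) hj1)
      · exact absurd ((hlam t ht 1 (le_refl 1) (hL t ht)).mpr (Or.inr (Or.inr ⟨hk, rfl⟩))) (notlam 1 (le_refl 1) hj1)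
      · obtain ⟨haL, hpre, hblue, hfree⟩ := h2 t ht hk
        by_cases ha0 : a t = 0
        · exact bundle_prefix_mem_cluster ends r L w e u hw0 harc ρ t ht j (le_of_lt hjL) fun j' h1' h2' =>
            (hfree j' h1' (by omega) (Or.inl ha0)).mpr fun hm => notlam j' h1' h2' (hξlam hm)
        · exact absurd (hξlam (hpre 1 (le_refl 1) (by omega)).1) (notlam 1 (le_refl 1) hj1)
  exact ⟨hbX, hbY, T2, T3⟩

end Coefficientwise

end Summit.CriticalPhenomena.PercolationContinuityZ3.Theorems
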